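import Literature.Computability.Complexity.CodeFPArith
import Mathlib.LinearAlgebra.Lagrange
import Mathlib.FieldTheory.Finite.Basic
import HarnessLib

/-!
# Typed polynomial time on codes, III: arithmetic modulo a carried modulus, `𝔽_p` through `ZMod p`

Trunk `CplxCore`, sequel of `CodeFP.lean` / `CodeFPArith.lean` (the predicate `CodeFP eα eβ g` and its
structural, numeral and list combinators). A verifier doing algebra over a prime field whose size
grows with the input — the sum-check / low-degree-test verifier of Babai–Fortnow–Lund for
exponential-time computations (`AlgebraicPCP.lean`), run over `𝔽_p` with `p = poly(n)` — computes
with RESIDUES: natural numbers below a modulus `p` that is itself part of the data. This file types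
that arithmetic once:

* the residue operations on `ℕ` with the modulus as first argument — `ModArith.addM`, `mulM`, `negM`,
  `subM`, `powM` (the convention of the brick `modExpFn`: `0` at moduli `≤ 1`), `invM` (`a^{p-2}`),
  the running residues `sumM`, `prodM` of a list, the evaluation `evalM` of a coefficient list
  (constant coefficient first) at a point, and the Lagrange data on the nodes `{0, …, h-1}`:
  `lagrNumM`, `lagrDenM`, `lagrM` (the value `L_e(x)` of the `e`-th Lagrange basis polynomial) and
  `eqPolyM` (`∑ₑ L_e(a) L_e(b)`, the kernel of the low-degree extension);
* their meaning in `ZMod p` (`natCast_addM`, …, `natCast_evalM`, **`natCast_lagrM`**: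
  `lagrM p h e x = (Lagrange.basis {0,…,h-1} id e).eval x` in `𝔽_p` for a prime `p ≥ h`, through
  `natCast_invM`, Fermat's little theorem), so that a machine-level computation is read as the
  field computation of the analysis;
* the typed leaves and combinators: `CodeFP.modExp` (the brick `modExpFn`, binary exponent),
  pointwise `CodeFP.modAdd`/`modMul`/`modNeg`/`modSub`/`modPow`/`modInv`/`modOf` over an arbitrary input
  code, the folds `CodeFP.sumMod`, `prodMod` on `(p, list)` (accumulator bounds discharged here once:
  the running residue of items read off the input has a code no longer than the input), and
  `CodeFP.evalMod`, `CodeFP.lagrNumMod`, `CodeFP.lagrMod`, `CodeFP.eqPolyMod`.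

Everything is proved; no machine, transducer or growth estimate is written at use sites.

## References

* S. Arora, B. Barak, *Computational Complexity: A Modern Approach*, CUP 2009, §1.3 (closure of
  polynomial time under composition and bounded loops), §8.6.1–8.6.2 and §11.5.2 (the arithmetic a
  sum-check verifier performs), §A.4 (the fields `GF(p)`, Fermat's little theorem) [AroraBarakCC2009].
* D. E. Knuth, *The Art of Computer Programming*, Vol. 2, 3rd ed., 1998, §4.6.3 (powers by
  square-and-multiply). (Schoolbook; the bricks are proved in the tree.)
* L. Babai, L. Fortnow, C. Lund, *Non-deterministic exponential time has two-prover interactive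
  protocols*, Comput. Complexity 1 (1991), §4 (the kernel `∑ₑ L_e(a) L_e(b)` of the low-degree
  extension) [BabaiFortnowLund1991].
-/

namespace Literature.Computability.Complexity

open _root_.Computability Polynomial Finset

/-! ### Residue arithmetic on `ℕ` -/

namespace ModArith

/-- Sum of residues. [folklore] -/
def addM (p a b : ℕ) : ℕ := (a + b) % p

/-- Product of residues. [folklore] -/
def mulM (p a b : ℕ) : ℕ := (a * b) % p

/-- Negation of a residue. [folklore] -/
def negM (p a : ℕ) : ℕ := (p - a % p) % p

/-- Difference of residues. [folklore] -/
def subM (p a b : ℕ) : ℕ := (a + (p - b % p)) % p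

/-- Power of a residue, binary exponent (the convention of `Brick.modExpFn`: `0` at moduli `≤ 1`).
[cite: AroraBarakCC2009, §A.4] -/
def powM (p a e : ℕ) : ℕ := if 2 ≤ p then a ^ e % p else 0

/-- Inverse of a residue modulo a prime: `a^{p-2}`. [cite: AroraBarakCC2009, §A.4 (Fermat)] -/
def invM (p a : ℕ) : ℕ := powM p a (p - 2)

/-- Running residue of the sum of a list. [folklore] -/
def sumM (p : ℕ) (l : List ℕ) : ℕ := l.foldl (fun acc c => (acc + c) % p) 0

/-- Running residue of the product of a list. [folklore] -/
def prodM (p : ℕ) (l : List ℕ) : ℕ := l.foldl (fun acc c => (acc * c) % p) (1 % p)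

/-- **Evaluation of a coefficient list at a point**, constant coefficient first:
`[c_0, …, c_k] ↦ ∑ c_i xⁱ mod p`. [folklore] -/
def evalM (p x : ℕ) (l : List ℕ) : ℕ :=
  sumM p (((List.range l.length).zip l).map fun ic => mulM p ic.2 (powM p x ic.1))

/-- Numerator of the Lagrange basis value on the nodes `{0, …, h-1}`: `∏_{j < h, j ≠ e} (x - j)`
(the factor `j = e` replaced by `1`). [folklore] -/
def lagrNumM (p h e x : ℕ) : ℕ := prodM p ((List.range h).map fun j => if j = e then 1 % p else subM p x j)

/-- Denominator of the Lagrange basis value: `∏_{j < h, j ≠ e} (e - j)`. [folklore] -/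
def lagrDenM (p h e : ℕ) : ℕ := lagrNumM p h e e

/-- **The Lagrange basis value** `L_e(x) = ∏_{j ≠ e} (x - j)/(e - j)` on the nodes `{0, …, h-1}` of `𝔽_p`.
[cite: BabaiFortnowLund1991, §4] -/
def lagrM (p h e x : ℕ) : ℕ := mulM p (lagrNumM p h e x) (invM p (lagrDenM p h e))

/-- **The kernel of the low-degree extension** `EQ(a, b) = ∑_{e < h} L_e(a) L_e(b)`. [cite: BabaiFortnowLund1991, §4] -/
def eqPolyM (p h a b : ℕ) : ℕ := sumM p ((List.range h).map fun e => mulM p (lagrM p h e a) (lagrM p h e b))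

/-! #### Elementary facts -/

/-- `sumM` is the sum reduced. [folklore] -/
theorem sumM_eq (p : ℕ) (l : List ℕ) : sumM p l = l.sum % p := by
  suffices h : ∀ acc, l.foldl (fun acc c => (acc + c) % p) (acc % p) = (acc + l.sum) % p by
    have := h 0
    rwa [Nat.zero_mod, zero_add] at this
  induction l with
  | nil => intro acc; rw [List.foldl_nil, List.sum_nil, add_zero]
  | cons c l ih =>
    intro acc
    rw [List.foldl_cons, Nat.mod_add_mod, ih, List.sum_cons, add_assoc]

/-- `prodM` is the product reduced. [folklore] -/
theorem prodM_eq (p : ℕ) (l : List ℕ) : prodM p l = l.prod % p := by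
  suffices h : ∀ acc, l.foldl (fun acc c => (acc * c) % p) (acc % p) = (acc * l.prod) % p by
    rw [prodM, h, one_mul]
  induction l with
  | nil => intro acc; rw [List.foldl_nil, List.prod_nil, mul_one]
  | cons c l ih =>
    intro acc
    rw [List.foldl_cons, Nat.mod_mul_mod, ih, List.prod_cons, mul_assoc]

/-- A running residue is at most the sum. [folklore] -/
theorem sumM_le_sum (p : ℕ) (l : List ℕ) : sumM p l ≤ l.sum := by rw [sumM_eq]; exact Nat.mod_le _ _

/-- A running product residue is at most the product. [folklore] -/
theorem prodM_le_prod (p : ℕ) (l : List ℕ) : prodM p l ≤ l.prod := by rw [prodM_eq]; exact Nat.mod_le _ _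

/-! #### Meaning in `ZMod p` -/

section CastFacts

variable {p : ℕ}

/-- `addM` is addition in `ZMod p`. [folklore] -/
theorem natCast_addM (a b : ℕ) : (addM p a b : ZMod p) = a + b := by
  rw [addM, ZMod.natCast_mod, Nat.cast_add]

/-- `mulM` is multiplication in `ZMod p`. [folklore] -/
theorem natCast_mulM (a b : ℕ) : (mulM p a b : ZMod p) = a * b := by
  rw [mulM, ZMod.natCast_mod, Nat.cast_mul]

/-- `negM` is negation in `ZMod p`. [folklore] -/
theorem natCast_negM [NeZero p] (a : ℕ) : (negM p a : ZMod p) = -a := by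
  rw [negM, ZMod.natCast_mod, Nat.cast_sub (Nat.mod_lt a (Nat.pos_of_ne_zero (NeZero.ne p))).le,
    ZMod.natCast_self, ZMod.natCast_mod, zero_sub]

/-- `subM` is subtraction in `ZMod p`. [folklore] -/
theorem natCast_subM [NeZero p] (a b : ℕ) : (subM p a b : ZMod p) = a - b := by
  rw [subM, ZMod.natCast_mod, Nat.cast_add, Nat.cast_sub (Nat.mod_lt b (Nat.pos_of_ne_zero (NeZero.ne p))).le,
    ZMod.natCast_self, ZMod.natCast_mod, zero_sub, sub_eq_add_neg]

/-- `powM` is the power in `ZMod p` (moduli `≥ 2`). [folklore] -/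
theorem natCast_powM (hp : 2 ≤ p) (a e : ℕ) : (powM p a e : ZMod p) = (a : ZMod p) ^ e := by
  rw [powM, if_pos hp, ZMod.natCast_mod, Nat.cast_pow]

/-- `sumM` is the sum in `ZMod p`. [folklore] -/
theorem natCast_sumM (l : List ℕ) : (sumM p l : ZMod p) = (l.map (Nat.cast : ℕ → ZMod p)).sum := by
  rw [sumM_eq, ZMod.natCast_mod, Nat.cast_list_sum]

/-- `prodM` is the product in `ZMod p`. [folklore] -/
theorem natCast_prodM (l : List ℕ) : (prodM p l : ZMod p) = (l.map (Nat.cast : ℕ → ZMod p)).prod := by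
  rw [prodM_eq, ZMod.natCast_mod, Nat.cast_list_prod]

/-- A sum over the list of the first `n` naturals is a `Finset.range` sum. [folklore] -/
theorem sum_map_range {M : Type*} [AddCommMonoid M] (f : ℕ → M) (n : ℕ) :
    ((List.range n).map f).sum = ∑ i ∈ range n, f i := by
  rw [← List.sum_toFinset _ List.nodup_range, List.toFinset_range]

/-- A product over the list of the first `n` naturals is a `Finset.range` product. [folklore] -/
theorem prod_map_range {M : Type*} [CommMonoid M] (f : ℕ → M) (n : ℕ) :
    ((List.range n).map f).prod = ∏ i ∈ range n, f i := by
  rw [← List.prod_toFinset _ List.nodup_range, List.toFinset_range]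

/-- **`evalM` is the polynomial value `∑ᵢ cᵢ xⁱ` in `ZMod p`** (moduli `≥ 2`). [folklore] -/
theorem natCast_evalM (hp : 2 ≤ p) (x : ℕ) (l : List ℕ) :
    (evalM p x l : ZMod p) = ∑ i ∈ range l.length, (l.getD i 0 : ZMod p) * (x : ZMod p) ^ i := by
  rw [evalM, natCast_sumM, List.map_map]
  have hz : (List.range l.length).zip l = (List.range l.length).map fun i => (i, l.getD i 0) := by
    apply List.ext_getElem
    · simp
    · intro i h1 h2
      rw [List.length_zip, List.length_range, min_self] at h1
      simp [List.getElem_zip, List.getElem?_eq_getElem h1]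
  rw [hz, List.map_map, sum_map_range]
  refine sum_congr rfl fun i _ => ?_
  simp only [Function.comp_apply, natCast_mulM, natCast_powM hp]

/-- The Lagrange numerator in `𝔽_p`: `∏_{j < h, j ≠ e} (x - j)`. [folklore] -/
theorem natCast_lagrNumM [NeZero p] (h e x : ℕ) :
    (lagrNumM p h e x : ZMod p) = ∏ j ∈ (range h).erase e, ((x : ZMod p) - j) := by
  have hf : ∀ j : ℕ, (((if j = e then 1 % p else subM p x j : ℕ)) : ZMod p) =
      if j = e then 1 else (x : ZMod p) - j := by
    intro j
    split_ifs
    · rw [ZMod.natCast_mod, Nat.cast_one]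
    · exact natCast_subM x j
  rw [lagrNumM, natCast_prodM, List.map_map]
  have h1 : ((List.range h).map ((Nat.cast : ℕ → ZMod p) ∘ fun j => if j = e then 1 % p else subM p x j)).prod =
      ∏ j ∈ range h, (if j = e then (1 : ZMod p) else (x : ZMod p) - j) := by
    rw [prod_map_range]
    exact prod_congr rfl fun j _ => hf j
  rw [h1, ← prod_erase (range h) (f := fun j => if j = e then (1 : ZMod p) else (x : ZMod p) - j) (a := e)
    (if_pos rfl)]
  exact prod_congr rfl fun j hj => if_neg (ne_of_mem_erase hj)

/-- `eqPolyM` is the sum `∑_{e < h} L_e(a) L_e(b)` of the residues it folds. [cite: BabaiFortnowLund1991, §4] -/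
theorem natCast_eqPolyM (h a b : ℕ) :
    (eqPolyM p h a b : ZMod p) = ∑ e ∈ range h, (lagrM p h e a : ZMod p) * (lagrM p h e b : ZMod p) := by
  rw [eqPolyM, natCast_sumM, List.map_map, sum_map_range]
  exact sum_congr rfl fun e _ => natCast_mulM _ _

end CastFacts

section NodeFacts

variable {p : ℕ} [NeZero p]

/-- The nodes `{0, …, h-1}` as a finset of `𝔽_p`. [folklore] -/
def nodes (p h : ℕ) : Finset (ZMod p) := (range h).image (Nat.cast : ℕ → ZMod p)

omit [NeZero p] in
/-- Below `p`, distinct naturals are distinct residues. [folklore] -/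
theorem natCast_ne_natCast [NeZero p] {a b : ℕ} (ha : a < p) (hb : b < p) (hab : a ≠ b) : (a : ZMod p) ≠ b := by
  intro h
  have := congr_arg ZMod.val h
  rw [ZMod.val_natCast, ZMod.val_natCast, Nat.mod_eq_of_lt ha, Nat.mod_eq_of_lt hb] at this
  exact hab this

/-- The nodes other than `e`: the image of `{0,…,h-1} ∖ {e}`. [folklore] -/
theorem nodes_erase {h : ℕ} (hh : h ≤ p) {e : ℕ} (he : e < h) :
    (nodes p h).erase (e : ZMod p) = ((range h).erase e).image (Nat.cast : ℕ → ZMod p) := by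
  ext y
  simp only [nodes, mem_erase, mem_image, mem_range]
  constructor
  · rintro ⟨hne, j, hj, rfl⟩
    exact ⟨j, ⟨fun hje => hne (by rw [hje]), hj⟩, rfl⟩
  · rintro ⟨j, ⟨hje, hj⟩, rfl⟩
    exact ⟨natCast_ne_natCast (lt_of_lt_of_le hj hh) (lt_of_lt_of_le he hh) hje, j, hj, rfl⟩

end NodeFacts

section PrimeFacts

variable {p : ℕ} [hp : Fact p.Prime]

/-- **`invM` is the inverse in `𝔽_p`** (Fermat: `a^{p-2} = a⁻¹`; at `a = 0` both sides vanish when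
`p ≠ 2`, and for `p = 2` the statement is asked only for units). [cite: AroraBarakCC2009, §A.4] -/
theorem natCast_invM (a : ℕ) (h : (a : ZMod p) ≠ 0 ∨ p ≠ 2) : (invM p a : ZMod p) = (a : ZMod p)⁻¹ := by
  have h2 : 2 ≤ p := hp.out.two_le
  rw [invM, natCast_powM h2]
  by_cases ha : (a : ZMod p) = 0
  · rcases h with h | h
    · exact absurd ha h
    · have h3 : 3 ≤ p := by
        rcases hp.out.eq_two_or_odd' with h' | h'
        · exact absurd h' h
        · have := h'.pos; omega
      rw [ha, inv_zero, zero_pow (by omega)]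
  · symm
    apply inv_eq_of_mul_eq_one_right
    rw [← pow_succ', show p - 2 + 1 = p - 1 by omega]
    exact ZMod.pow_card_sub_one_eq_one ha

/-- The Lagrange denominator is a unit: the nodes are distinct. [folklore] -/
theorem natCast_lagrDenM_ne_zero {h : ℕ} (hh : h ≤ p) {e : ℕ} (he : e < h) : (lagrDenM p h e : ZMod p) ≠ 0 := by
  rw [lagrDenM, natCast_lagrNumM, prod_ne_zero_iff]
  intro j hj
  have hje := ne_of_mem_erase hj
  have hj' := mem_range.1 (mem_of_mem_erase hj)
  exact sub_ne_zero.2 (natCast_ne_natCast (lt_of_lt_of_le he hh) (lt_of_lt_of_le hj' hh) (Ne.symm hje))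

/-- **`lagrM` is the value of the Lagrange basis polynomial of the node `e` among `{0, …, h-1} ⊆ 𝔽_p`**
(`p` prime, `h ≤ p`, `e < h`). [cite: BabaiFortnowLund1991, §4] -/
theorem natCast_lagrM {h : ℕ} (hh : h ≤ p) {e : ℕ} (he : e < h) (x : ℕ) :
    (lagrM p h e x : ZMod p) = (Lagrange.basis (nodes p h) id (e : ZMod p)).eval (x : ZMod p) := by
  have hL : (Lagrange.basis (nodes p h) id (e : ZMod p)).eval (x : ZMod p) =
      ∏ j ∈ (range h).erase e, (((e : ZMod p) - (j : ZMod p))⁻¹ * ((x : ZMod p) - (j : ZMod p))) := by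
    rw [Lagrange.basis, eval_prod, nodes_erase hh he, prod_image]
    · refine prod_congr rfl fun j _ => ?_
      simp only [Lagrange.basisDivisor, id, eval_mul, eval_C, eval_sub, eval_X]
    · intro a ha b hb hab
      have ha' := mem_range.1 (mem_of_mem_erase ha)
      have hb' := mem_range.1 (mem_of_mem_erase hb)
      by_contra hne
      exact natCast_ne_natCast (lt_of_lt_of_le ha' hh) (lt_of_lt_of_le hb' hh) hne hab
  rw [hL, prod_mul_distrib, prod_inv_distrib, lagrM, natCast_mulM,
    natCast_invM _ (Or.inl (natCast_lagrDenM_ne_zero hh he)), lagrDenM, natCast_lagrNumM, natCast_lagrNumM, mul_comm]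

end PrimeFacts

end ModArith

/-! ### Sizes of numerals -/

namespace CodeFP

open ModArith Brick

variable {α σ : Type} {eα : α → List Bool} {eσ : σ → List Bool}

/-- `n < 2^k ⟹ |bin n| ≤ k`. [folklore] -/
theorem length_natE_le_of_lt {n k : ℕ} (h : n < 2 ^ k) : (natE n).length ≤ k := by
  rw [show natE n = encodeNat n from rfl, TM2Pass.length_encodeNat_eq_size]
  exact Nat.size_le.2 h

/-- `n < 2^{|bin n|}`. [folklore] -/
theorem lt_two_pow_length_natE (n : ℕ) : n < 2 ^ (natE n).length := by
  have := bitsToNat_lt (natE n)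
  rwa [bitsToNat_natE] at this

/-- Numeral length is monotone. [folklore] -/
theorem length_natE_mono {m n : ℕ} (h : m ≤ n) : (natE m).length ≤ (natE n).length :=
  length_natE_le_of_lt (lt_of_le_of_lt h (lt_two_pow_length_natE n))

/-- **A sum of numerals read off a raw list is shorter than the list code.** [folklore] -/
theorem sum_lt_two_pow_length_rawE (l : List ℕ) : l.sum < 2 ^ (rawE natE l).length := by
  induction l with
  | nil => simp
  | cons c l ih =>
    rw [List.sum_cons, rawE_cons, length_boolPair]
    have hc := lt_two_pow_length_natE c
    calc c + l.sum < 2 ^ (natE c).length + 2 ^ (rawE natE l).length := Nat.add_lt_add hc ih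
      _ ≤ 2 ^ ((natE c).length + (rawE natE l).length) + 2 ^ ((natE c).length + (rawE natE l).length) :=
          Nat.add_le_add (Nat.pow_le_pow_right Nat.two_pos (by omega)) (Nat.pow_le_pow_right Nat.two_pos (by omega))
      _ = 2 ^ ((natE c).length + (rawE natE l).length + 1) := by rw [pow_succ]; ring
      _ ≤ 2 ^ (2 * (natE c).length + 2 + (rawE natE l).length) := Nat.pow_le_pow_right Nat.two_pos (by omega)

/-- **A product of numerals read off a raw list is at most one symbol longer than the list code.** [folklore] -/
theorem prod_lt_two_pow_length_rawE_succ (l : List ℕ) : l.prod < 2 ^ ((rawE natE l).length + 1) := by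
  suffices h : l.prod ≤ 2 ^ (rawE natE l).length from lt_of_le_of_lt h (Nat.pow_lt_pow_right (by norm_num) (by omega))
  induction l with
  | nil => simp
  | cons c l ih =>
    rw [List.prod_cons, rawE_cons, length_boolPair]
    have hc := (lt_two_pow_length_natE c).le
    calc c * l.prod ≤ 2 ^ (natE c).length * 2 ^ (rawE natE l).length := Nat.mul_le_mul hc ih
      _ = 2 ^ ((natE c).length + (rawE natE l).length) := by rw [pow_add]
      _ ≤ 2 ^ (2 * (natE c).length + 2 + (rawE natE l).length) := Nat.pow_le_pow_right Nat.two_pos (by omega)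

/-! ### Typed residue arithmetic -/

/-- **Modular exponentiation** `(a, e, m) ↦ aᵉ mod m` with a binary exponent (square-and-multiply,
the brick `modExpFn`; `0` at moduli `≤ 1`). [cite: AroraBarakCC2009, §A.4] -/
theorem modExp : CodeFP (pairE natE (pairE natE natE)) natE (fun t => powM t.2.2 t.1 t.2.1) := by
  refine ⟨modExpFn, modExpFn_mem_FP, fun t => ?_⟩
  obtain ⟨a, e, m⟩ := t
  simp only [pairE_apply, powM]
  by_cases hm : 2 ≤ m
  · rw [modExpFn_boolPair (by simpa using hm), if_pos hm]
    simp
  · rw [modExpFn_boolPair_of_le (by simp only [bitsToNat_natE]; omega), if_neg hm]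
    rfl

/-- Reduction of a computed numeral modulo a computed modulus. [folklore] -/
theorem modOf {P A : α → ℕ} (hP : CodeFP eα natE P) (hA : CodeFP eα natE A) :
    CodeFP eα natE (fun a => A a % P a) := natMod.comp (hA.pair hP)

/-- Pointwise `addM`. [folklore] -/
theorem modAdd {P A B : α → ℕ} (hP : CodeFP eα natE P) (hA : CodeFP eα natE A) (hB : CodeFP eα natE B) :
    CodeFP eα natE (fun a => addM (P a) (A a) (B a)) := natMod.comp ((natAdd.comp (hA.pair hB)).pair hP)

/-- Pointwise `mulM`. [folklore] -/
theorem modMul {P A B : α → ℕ} (hP : CodeFP eα natE P) (hA : CodeFP eα natE A) (hB : CodeFP eα natE B) :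
    CodeFP eα natE (fun a => mulM (P a) (A a) (B a)) := natMod.comp ((natMul.comp (hA.pair hB)).pair hP)

/-- Pointwise `negM`. [folklore] -/
theorem modNeg {P A : α → ℕ} (hP : CodeFP eα natE P) (hA : CodeFP eα natE A) :
    CodeFP eα natE (fun a => negM (P a) (A a)) := natMod.comp ((natSub.comp (hP.pair (modOf hP hA))).pair hP)

/-- Pointwise `subM`. [folklore] -/
theorem modSub {P A B : α → ℕ} (hP : CodeFP eα natE P) (hA : CodeFP eα natE A) (hB : CodeFP eα natE B) :
    CodeFP eα natE (fun a => subM (P a) (A a) (B a)) :=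
  natMod.comp ((natAdd.comp (hA.pair (natSub.comp (hP.pair (modOf hP hB))))).pair hP)

/-- Pointwise `powM` (binary exponent). [folklore] -/
theorem modPow {P A E : α → ℕ} (hP : CodeFP eα natE P) (hA : CodeFP eα natE A) (hE : CodeFP eα natE E) :
    CodeFP eα natE (fun a => powM (P a) (A a) (E a)) := modExp.comp (hA.pair (hE.pair hP))

/-- Pointwise `invM`. [cite: AroraBarakCC2009, §A.4] -/
theorem modInv {P A : α → ℕ} (hP : CodeFP eα natE P) (hA : CodeFP eα natE A) :
    CodeFP eα natE (fun a => invM (P a) (A a)) := modPow hP hA (natSub.comp (hP.pair (const eα 2)))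

/-! ### Folds: running residues of sums and products -/

/-- **The running residue of a sum**: `(p, [c_1, …, c_k]) ↦ ∑ cᵢ mod p` (a left fold whose accumulator,
at most the sum of the items read, is no longer than the input). [cite: AroraBarakCC2009, §1.3 (bounded loops)] -/
theorem sumMod : CodeFP (pairE natE (rawE natE)) natE (fun q => sumM q.1 q.2) := by
  have hstep : CodeFP (pairE natE (pairE natE natE)) natE (fun t => (t.2.2 + t.2.1) % t.1) :=
    natMod.comp ((natAdd.comp ((snd _ _).snd'.pair (snd _ _).fst')).pair (fst _ _))
  have h := foldl (σ := ℕ) (α := ℕ) (β := ℕ) (eσ := natE) (eα := natE) (eβ := natE)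
    (step := fun p c acc => (acc + c) % p) (init := fun _ => 0) hstep (const natE 0) X
    (fun s l₁ l₂ => by
      rw [eval_X, pairE_apply, length_boolPair, rawE_append, List.length_append]
      have h1 : (natE (l₁.foldl (fun acc c => (acc + c) % s) 0)).length ≤ (rawE natE l₁).length :=
        length_natE_le_of_lt (lt_of_le_of_lt (sumM_le_sum s l₁) (sum_lt_two_pow_length_rawE l₁))
      omega)
  exact h.congr fun q => rfl

/-- **The running residue of a product**: `(p, [c_1, …, c_k]) ↦ ∏ cᵢ mod p`. [cite: AroraBarakCC2009, §1.3 (bounded loops)] -/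
theorem prodMod : CodeFP (pairE natE (rawE natE)) natE (fun q => prodM q.1 q.2) := by
  have hstep : CodeFP (pairE natE (pairE natE natE)) natE (fun t => (t.2.2 * t.2.1) % t.1) :=
    natMod.comp ((natMul.comp ((snd _ _).snd'.pair (snd _ _).fst')).pair (fst _ _))
  have hinit : CodeFP natE natE (fun p => 1 % p) := natMod.comp ((const natE 1).pair (CodeFP.id natE))
  have h := foldl (σ := ℕ) (α := ℕ) (β := ℕ) (eσ := natE) (eα := natE) (eβ := natE)
    (step := fun p c acc => (acc * c) % p) (init := fun p => 1 % p) hstep hinit (X + 1)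
    (fun s l₁ l₂ => by
      rw [eval_add, eval_X, eval_one, pairE_apply, length_boolPair, rawE_append, List.length_append]
      have h1 : (natE (l₁.foldl (fun acc c => (acc * c) % s) (1 % s))).length ≤ (rawE natE l₁).length + 1 :=
        length_natE_le_of_lt (lt_of_le_of_lt (prodM_le_prod s l₁) (prod_lt_two_pow_length_rawE_succ l₁))
      omega)
  exact h.congr fun q => rfl

/-- Pointwise running sum of a computed list modulo a computed modulus. [folklore] -/
theorem modSum {P : α → ℕ} {L : α → List ℕ} (hP : CodeFP eα natE P) (hL : CodeFP eα (rawE natE) L) :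
    CodeFP eα natE (fun a => sumM (P a) (L a)) := sumMod.comp (hP.pair hL)

/-- Pointwise running product of a computed list modulo a computed modulus. [folklore] -/
theorem modProd {P : α → ℕ} {L : α → List ℕ} (hP : CodeFP eα natE P) (hL : CodeFP eα (rawE natE) L) :
    CodeFP eα natE (fun a => prodM (P a) (L a)) := prodMod.comp (hP.pair hL)

/-! ### Evaluation, Lagrange basis values, the kernel -/

/-- **Evaluation of a coefficient list** `((p, x), [c_0, …, c_k]) ↦ ∑ cᵢ xⁱ mod p`. [cite: AroraBarakCC2009, §8.6.1] -/
theorem evalMod : CodeFP (pairE (pairE natE natE) (rawE natE)) natE (fun q => evalM q.1.1 q.1.2 q.2) := by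
  -- context `(p, x)`, item `(i, c)`
  have hP : CodeFP (pairE (pairE natE natE) (pairE natE natE)) natE (fun t => t.1.1) := (fst _ _).fst'
  have hg : CodeFP (pairE (pairE natE natE) (pairE natE natE)) natE
      (fun t => mulM t.1.1 t.2.2 (powM t.1.1 t.1.2 t.2.1)) :=
    modMul hP (snd _ _).snd' (modPow hP (fst _ _).snd' (snd _ _).fst')
  refine (sumMod.comp ((fst _ _).fst'.pair ((map hg).comp ((fst _ _).pair ((rawEnum natE).comp (snd _ _)))))).congr
    fun q => ?_
  rfl

/-- **The Lagrange numerator** `((p, 1ʰ), (e, x)) ↦ ∏_{j < h, j ≠ e} (x - j) mod p`. [cite: BabaiFortnowLund1991, §4] -/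
theorem lagrNumMod : CodeFP (pairE (pairE natE unE) (pairE natE natE)) natE (fun q => lagrNumM q.1.1 q.1.2 q.2.1 q.2.2) := by
  -- context `((p, 1ʰ), (e, x))`, item `j`
  have hP : CodeFP (pairE (pairE (pairE natE unE) (pairE natE natE)) natE) natE (fun t => t.1.1.1) := (fst _ _).fst'.fst'
  have hE : CodeFP (pairE (pairE (pairE natE unE) (pairE natE natE)) natE) natE (fun t => t.1.2.1) := (fst _ _).snd'.fst'
  have hX : CodeFP (pairE (pairE (pairE natE unE) (pairE natE natE)) natE) natE (fun t => t.1.2.2) := (fst _ _).snd'.snd'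
  have hJ : CodeFP (pairE (pairE (pairE natE unE) (pairE natE natE)) natE) natE (fun t => t.2) := snd _ _
  have hg : CodeFP (pairE (pairE (pairE natE unE) (pairE natE natE)) natE) natE
      (fun t => if decide (t.2 = t.1.2.1) then 1 % t.1.1.1 else subM t.1.1.1 t.1.2.2 t.2) :=
    (natEq.comp (hJ.pair hE)).ite (modOf hP (const _ 1)) (modSub hP hX hJ)
  refine (prodMod.comp ((fst _ _).fst'.pair ((map hg).comp ((CodeFP.id _).pair
    (urange.comp (fst _ _).snd'))))).congr fun q => ?_
  obtain ⟨⟨p, h⟩, e, x⟩ := q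
  change prodM p (List.map _ (List.range h)) = prodM p _
  congr 1
  refine List.map_congr_left fun j _ => ?_
  by_cases hje : j = e
  · simp [hje]
  · simp [hje]

/-- **The Lagrange basis value** `((p, 1ʰ), (e, x)) ↦ L_e(x)`. [cite: BabaiFortnowLund1991, §4] -/
theorem lagrMod : CodeFP (pairE (pairE natE unE) (pairE natE natE)) natE (fun q => lagrM q.1.1 q.1.2 q.2.1 q.2.2) := by
  have hden : CodeFP (pairE (pairE natE unE) (pairE natE natE)) natE (fun q => lagrDenM q.1.1 q.1.2 q.2.1) :=
    (lagrNumMod.comp ((fst _ _).pair ((snd _ _).fst'.pair (snd _ _).fst'))).congr fun q => rfl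
  exact modMul (fst _ _).fst' lagrNumMod (modInv (fst _ _).fst' hden)

/-- **The kernel of the low-degree extension** `((p, 1ʰ), (a, b)) ↦ ∑_{e < h} L_e(a) L_e(b) mod p`.
[cite: BabaiFortnowLund1991, §4] -/
theorem eqPolyMod : CodeFP (pairE (pairE natE unE) (pairE natE natE)) natE (fun q => eqPolyM q.1.1 q.1.2 q.2.1 q.2.2) := by
  -- context `((p, 1ʰ), (a, b))`, item `e`
  have hC : CodeFP (pairE (pairE (pairE natE unE) (pairE natE natE)) natE) (pairE natE unE) (fun t => t.1.1) := (fst _ _).fst'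
  have hA : CodeFP (pairE (pairE (pairE natE unE) (pairE natE natE)) natE) natE (fun t => t.1.2.1) := (fst _ _).snd'.fst'
  have hB : CodeFP (pairE (pairE (pairE natE unE) (pairE natE natE)) natE) natE (fun t => t.1.2.2) := (fst _ _).snd'.snd'
  have hEi : CodeFP (pairE (pairE (pairE natE unE) (pairE natE natE)) natE) natE (fun t => t.2) := snd _ _
  have hLa : CodeFP (pairE (pairE (pairE natE unE) (pairE natE natE)) natE) natE
      (fun t => lagrM t.1.1.1 t.1.1.2 t.2 t.1.2.1) := (lagrMod.comp (hC.pair (hEi.pair hA))).congr fun _ => rfl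
  have hLb : CodeFP (pairE (pairE (pairE natE unE) (pairE natE natE)) natE) natE
      (fun t => lagrM t.1.1.1 t.1.1.2 t.2 t.1.2.2) := (lagrMod.comp (hC.pair (hEi.pair hB))).congr fun _ => rfl
  have hg := modMul hC.fst' hLa hLb
  refine (sumMod.comp ((fst _ _).fst'.pair ((map hg).comp ((CodeFP.id _).pair
    (urange.comp (fst _ _).snd'))))).congr fun q => ?_
  rfl

end CodeFP

end Literature.Computability.Complexity
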